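import Literature.Probability.RandomPlanarGeometry.SLEBubblesClosedFill
import Literature.Probability.RandomPlanarGeometry.SLEBubblesRealLine
import Literature.Probability.RandomPlanarGeometry.HalfPlaneFillProofs
import HarnessLib

/-!
# [LSW] Theorem 7.3 from (7.3) alone: the closed filling `F^ℝ_ℍ(cl(γ ∪ ⋃ X̂)) ∩ ℍ` is a measurable `Ω`-valued version containing `Ξ(κ)`, with law `P_{α_κ}`

Proof-only file (no definition, no named fact), after

* G. F. Lawler, O. Schramm, W. Werner, *Conformal restriction: the chordal case*, J. Amer. Math.
  Soc. **16** (2003) 917–955, arXiv:math/0209343 (**[LSW]**, arXiv page numbers), Thm. 7.3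
  (p. 29: "For any `κ ∈ [0, 8/3]`, the law of `Ξ(κ)` is `P_{α_κ}`") with eq. (7.3)
  ("`P[Ξ ∩ A = ∅] = Φ'_A(0)^α`"), §3 p. 10 (the σ-field of `Ω`), and §2 (2.4) with Prop. 4.1
  (monotonicity and outer continuity of `A ↦ Φ'_A(0)`, the tree's
  `HasRestrictionDeriv.exists_forall_outer_ge`, file `RestrictionDerivOuter`).

Given ONLY the avoidance formula (7.3) for `Ξ(κ)` (the named fact `SLEBubbles.measure_disjoint`,
hypothesis `h₂`; in the tree it follows from [LSW] Thm. 6.5, `SLEBubbles.measure_disjoint_of_thm65`)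
we PROVE, for `0 < κ ≤ 8/3`, a Brownian bubble measure and an independent Poisson cloud with mean
`λ_κ μ ⊗ dt`:

* `SLEBubbles.measure_disjoint_sleClosedBubbleSet_and_nullMeasurableSet` — **the sandwich**: for
  `A ∈ 𝒬*` with data `(Φ, d)`, the event `{K'' ∩ A = ∅}`, `K'' = F^ℝ_ℍ(cl(γ ∪ ⋃ X̂)) ∩ ℍ`
  (`sleClosedBubbleSet`), has probability `d^{α_κ}` and is null-measurable: it contains
  `{Ξ ∩ thickHull A s = ∅}` for all small `s > 0` (`disjoint_sleClosedBubbleSet_of_disjoint_thickHull`,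
  by the chain lemma of `SLEBubblesClosedFill`) and is contained in `{Ξ ∩ A = ∅}` (`Ξ ⊆ K''`),
  events of probabilities `Φ'_{thickHull A s}(0)^α ↑ Φ'_A(0)^α` (outer continuity), so it is
  a.e. equal to the countable union of the former;
* `SLEBubbles.ae_sleClosedBubbleSet_mem_restrictionConfigs` — **a.s. `K'' ∈ Ω`**: Rohde–Schramm's
  simple-path theorem (`SLEBubbles.ae_isSimpleTrace_sleTrace`, proved), no bubble at time `0`
  (`SLEBubbles.ae_forall_snd_ne_zero`), the p. 29 statement `cl Ξ ∩ (ℝ ∖ {0}) = ∅`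
  (`SLEBubblesRealLine`, from (7.3)), and the deterministic `sleClosedBubbleSet_mem_restrictionConfigs`;
* `SLEBubbles.exists_measurable_sleClosedBubbleSet_version` — a measurable `Kc : _ → Ω` equal to
  `K''` a.e. (`RestrictionConfig.exists_measurable_version_of_nullMeasurableSet`, `SLEBubblesVersion`);
* `SLEBubbles.isRestrictionMeasure_map_of_measure_disjoint` — **Thm. 7.3 in law form from (7.3)
  alone**: `Kc` is measurable, a.s. `Ξ(κ) ⊆ Kc = K''`, and `law(Kc) = P_{α_κ}`. This is
  `SLEBubbles.isRestrictionMeasure_map` with its hypothesis `SLEBubbles.exists_measurable_version`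
  REMOVED (and `Kc = Ξ` a.e. weakened to `Ξ ⊆ Kc` a.e., all that any dependent uses; equality
  holds by [LSW]'s closedness statement of p. 29, which the tree no longer needs).

The parent assemblies (existence of `P_α`; the `α > 5/8` leaf; p. 5 results) rewired on `h₂`
alone are in `SLEBubblesClosedFillAssembly`.

Mathlib: `measure_sdiff'`, `ae_eq_set`, `ae_le_set`, `measure_mono_ae`, `le_of_tendsto'`,
`NullMeasurableSet.congr`, `Measure.quasiMeasurePreserving_fst/snd`.
-/

noncomputable section

open Set Filter Topology MeasureTheory Metric Bornology
open UpperHalfPlane (upperHalfPlaneSet isOpen_upperHalfPlaneSet)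
open scoped NNReal ENNReal
open Literature.Probability.Process (preWienerMeasure IsPoissonCloud)

namespace Literature.Probability.RandomPlanarGeometry

/-! ### Avoidance events of the closed filling: the sandwich by thickened hulls -/

section Events

variable {κ : ℝ≥0} {ω : ℝ≥0 → ℝ} {X : Set (BubbleConfig × ℝ≥0)} {A : Set ℂ}

/-- **If `Ξ(κ)` misses the thickened hull `thickHull A s`, the closed filling misses `A`**
(`γ(0, ∞) ∪ ⋃ X̂ ⊆ Ξ` then misses the `s`-neighbourhood of `A` in `ℍ̄`, hence so does its closure,
and the chain lemma `disjoint_twoSidedFilling_of_forall_disjoint_ball` applies). [folklore] -/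
theorem disjoint_sleClosedBubbleSet_of_disjoint_thickHull (hA : IsStarHull A)
    (hY : sleBubbleUnion κ ω X ⊆ upperHalfPlaneSet) {s : ℝ} (hs : 0 < s)
    (h : Disjoint (sleBubbleSet κ ω X) (thickHull A s)) :
    Disjoint (sleClosedBubbleSet κ ω X) A := by
  have hYΞ := sleBubbleUnion_subset_sleBubbleSet hY
  refine Disjoint.mono_left inter_subset_left ?_
  refine disjoint_twoSidedFilling_of_forall_disjoint_ball hA hs fun a ha ↦ ?_
  refine Set.disjoint_left.2 fun w hwcl hwball ↦ ?_
  obtain ⟨y, hy⟩ : (ball a s ∩ sleBubbleUnion κ ω X).Nonempty :=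
    mem_closure_iff_nhds.1 hwcl (ball a s) (isOpen_ball.mem_nhds hwball.1)
  have hyH : y ∈ upperHalfPlaneSet := hY hy.2
  have hyN : y ∈ nbhdSet A s :=
    ⟨mem_cthickening_of_dist_le y a s A ha (le_of_lt (mem_ball.1 hy.1)),
      le_of_lt (show 0 < y.im from hyH)⟩
  have hyT : y ∈ thickHull A s := inter_subset_hpFill _ ⟨hyN, hyH⟩
  exact Set.disjoint_left.1 h (hYΞ hy.2) hyT

/-- A `*`-hull lies in each of its thickened hulls (`A = cl(A ∩ ℍ)` and `A ∩ ℍ ⊆ thickHull A s`,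
closed). [folklore] -/
theorem IsStarHull.subset_thickHull (hA : IsStarHull A) (s : ℝ) : A ⊆ thickHull A s := by
  have h : closure (A ∩ upperHalfPlaneSet) ⊆ thickHull A s :=
    closure_minimal (inter_subset_thickHull hA.isBoundedHull.subset_closure s) (isClosed_thickHull A s)
  rwa [hA.isBoundedHull.2.1] at h

end Events

/-! ### The law of the closed filling from (7.3) -/

section Law

variable {κ : ℝ≥0} {μ : Measure BubbleConfig} {Ω' : Type} [MeasurableSpace Ω'] {P' : Measure Ω'}
  {X : Ω' → Set (BubbleConfig × ℝ≥0)}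

/-- **The sandwich.** For `0 < κ ≤ 8/3`, a Brownian bubble measure, an independent Poisson cloud
with mean `λ_κ μ ⊗ dt`, the avoidance formula (7.3) for `Ξ(κ)` (`h₂`) and a `*`-hull `A` with
restriction data `(Φ, d)`: the event `{F^ℝ_ℍ(cl(γ ∪ ⋃ X̂)) ∩ ℍ ∩ A = ∅}` has probability
`d^{α_κ}` and is null-measurable. It contains `{Ξ ∩ thickHull A s = ∅}` for every small `s > 0`
(`disjoint_sleClosedBubbleSet_of_disjoint_thickHull`) and is contained in `{Ξ ∩ A = ∅}`
(`Ξ ⊆` the closed filling), events of probabilities `Φ'_{thickHull A s}(0)^α → Φ'_A(0)^α` by the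
outer continuity of the restriction derivative (`HasRestrictionDeriv.exists_forall_outer_ge`).
[cite: LawlerSchrammWerner2003Restriction, Thm. 7.3 with eq. (7.3) (pp. 28–29)] -/
theorem SLEBubbles.measure_disjoint_sleClosedBubbleSet_and_nullMeasurableSet
    (h₂ : SLEBubbles.measure_disjoint) (hκ0 : 0 < κ) (hκ : κ ≤ 8 / 3)
    (hμ : IsBrownianBubbleMeasure μ) (hX : IsPoissonCloud (bubbleCloudIntensity κ μ) X P')
    {A : Set ℂ} (hA : IsStarHull A)
    {Φ : ConformalEquiv (upperHalfPlaneSet \ A) upperHalfPlaneSet} (hΦ : IsRestrictionMap A Φ)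
    {d : ℝ} (hd : HasRestrictionDeriv A Φ d) :
    (preWienerMeasure.prod P') {p | Disjoint (sleClosedBubbleSet κ p.1 (X p.2)) A} =
        ENNReal.ofReal (d ^ sleBubbleExponent κ) ∧
      NullMeasurableSet {p : (ℝ≥0 → ℝ) × Ω' | Disjoint (sleClosedBubbleSet κ p.1 (X p.2)) A}
        (preWienerMeasure.prod P') := by
  haveI : IsProbabilityMeasure preWienerMeasure := isProbabilityMeasure_preWienerMeasure'
  haveI : IsProbabilityMeasure P' := hX.isProbabilityMeasure
  set P : Measure ((ℝ≥0 → ℝ) × Ω') := preWienerMeasure.prod P' with hPdef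
  set α : ℝ := sleBubbleExponent κ with hαdef
  have hα0 : 0 ≤ α := sleBubbleExponent_nonneg hκ
  have hY : ∀ᵐ p ∂P, sleBubbleUnion κ p.1 (X p.2) ⊆ upperHalfPlaneSet :=
    (SLEBubbles.ae_isSimpleTrace_fst hκ0 hκ P').mono fun p hp ↦
      sleBubbleUnion_subset_upperHalfPlaneSet hp _
  set E : Set ((ℝ≥0 → ℝ) × Ω') := {p | Disjoint (sleClosedBubbleSet κ p.1 (X p.2)) A} with hE
  set V : Set ((ℝ≥0 → ℝ) × Ω') := {p | Disjoint (sleBubbleSet κ p.1 (X p.2)) A} with hV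
  have hEV : E ≤ᵐ[P] V := hY.mono fun p hp hpE ↦
    Disjoint.mono_left (sleBubbleSet_subset_sleClosedBubbleSet hp) hpE
  have hPV : P V = ENNReal.ofReal (d ^ α) := h₂ hκ0 hκ hμ hX hA hΦ hd
  rcases A.eq_empty_or_nonempty with hA0 | hne
  · have hEuniv : E = univ := by
      ext p
      simp [hE, hA0]
    have hVuniv : V = univ := by
      ext p
      simp [hV, hA0]
    refine ⟨?_, by rw [hEuniv]; exact nullMeasurableSet_univ⟩
    rw [hEuniv, ← hVuniv, hPV]
  -- restriction data: `0 < d ≤ 1`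
  obtain ⟨d', hd'0, -, hd'⟩ := IsStarHull.exists_hasRestrictionDeriv_holds hA hΦ
  obtain rfl : d = d' := hd.unique hA hd'
  -- thickened hulls of `A` are `*`-hulls
  obtain ⟨s₀, hs₀, hstar⟩ :=
    exists_forall_isStarHull_thickHull isSimplyConnected_of_isConnected_compl_holds hA
  -- for each `n`, a thickened hull with derivative `≥ (1 - 1/(n+1)) d`
  have hdata : ∀ n : ℕ, ∃ s : ℝ, 0 < s ∧ IsStarHull (thickHull A s) ∧
      ENNReal.ofReal (((1 - 1 / ((n : ℝ) + 1)) * d) ^ α) ≤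
        P {p | Disjoint (sleBubbleSet κ p.1 (X p.2)) (thickHull A s)} := by
    intro n
    have hε : (0 : ℝ) < 1 / ((n : ℝ) + 1) := by positivity
    obtain ⟨δ, hδ, hout⟩ := hd.exists_forall_outer_ge hA hne hΦ hε
    set s : ℝ := min δ (s₀ / 2) with hs
    have hs0 : 0 < s := lt_min hδ (by positivity)
    have hss₀ : s < s₀ := (min_le_right _ _).trans_lt (by linarith)
    have hH : IsStarHull (thickHull A s) := hstar s hs0.le hss₀
    obtain ⟨Ψ, hΨ, -⟩ := IsStarHull.existsUnique_isRestrictionMap_holds hH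
    obtain ⟨e, -, -, he⟩ := IsStarHull.exists_hasRestrictionDeriv_holds hH hΨ
    have hle : (1 - 1 / ((n : ℝ) + 1)) * d ≤ e :=
      hout hH (hA.subset_thickHull s) (thickHull_mono A (min_le_left _ _)) hΨ he
    refine ⟨s, hs0, hH, ?_⟩
    rw [show P {p | Disjoint (sleBubbleSet κ p.1 (X p.2)) (thickHull A s)} = ENNReal.ofReal (e ^ α)
      from h₂ hκ0 hκ hμ hX hH hΨ he]
    refine ENNReal.ofReal_le_ofReal (Real.rpow_le_rpow ?_ hle hα0)
    have : 0 ≤ 1 - 1 / ((n : ℝ) + 1) := by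
      rw [sub_nonneg, div_le_one (by positivity)]
      linarith
    exact mul_nonneg this hd'0.le
  choose s hs0 hH hPU using hdata
  set U : ℕ → Set ((ℝ≥0 → ℝ) × Ω') :=
    fun n ↦ {p | Disjoint (sleBubbleSet κ p.1 (X p.2)) (thickHull A (s n))} with hU
  have hUmeas : ∀ n, NullMeasurableSet (U n) P := fun n ↦
    SLEBubbles.nullMeasurableSet_disjoint_holds hκ0 hκ hμ hX (hH n)
  have hUE : ∀ n, U n ≤ᵐ[P] E := fun n ↦ hY.mono fun p hp hpU ↦
    disjoint_sleClosedBubbleSet_of_disjoint_thickHull hA hp (hs0 n) hpU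
  set W : Set ((ℝ≥0 → ℝ) × Ω') := ⋃ n, U n with hW
  have hWmeas : NullMeasurableSet W P := NullMeasurableSet.iUnion hUmeas
  have hWE : W ≤ᵐ[P] E := by
    have hall := ae_all_iff.2 hUE
    filter_upwards [hall] with p hp hpW
    obtain ⟨n, hn⟩ := mem_iUnion.1 hpW
    exact hp n hn
  have hWV : W ≤ᵐ[P] V := hWE.trans hEV
  -- the measure of `W`
  have hWle : P W ≤ ENNReal.ofReal (d ^ α) := (measure_mono_ae hWV).trans_eq hPV
  have hlim : Tendsto (fun n : ℕ ↦ ENNReal.ofReal (((1 - 1 / ((n : ℝ) + 1)) * d) ^ α)) atTop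
      (𝓝 (ENNReal.ofReal (d ^ α))) := by
    have h1 : Tendsto (fun n : ℕ ↦ (1 - 1 / ((n : ℝ) + 1)) * d) atTop (𝓝 d) := by
      have := ((tendsto_one_div_add_atTop_nhds_zero_nat (𝕜 := ℝ)).const_sub 1).mul_const d
      simpa using this
    have h2 : Tendsto (fun x : ℝ ↦ x ^ α) (𝓝 d) (𝓝 (d ^ α)) :=
      (Real.continuousAt_rpow_const d α (Or.inl hd'0.ne')).tendsto
    exact (ENNReal.continuous_ofReal.tendsto _).comp (h2.comp h1)
  have hWge : ENNReal.ofReal (d ^ α) ≤ P W :=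
    le_of_tendsto' hlim fun n ↦ (hPU n).trans (measure_mono (subset_iUnion U n))
  have hPW : P W = ENNReal.ofReal (d ^ α) := le_antisymm hWle hWge
  -- `E =ᵐ W`
  have hVW : P (V ∪ W) = ENNReal.ofReal (d ^ α) := by
    refine le_antisymm ?_ (hPV ▸ measure_mono subset_union_left)
    calc P (V ∪ W) ≤ P V := by
          refine measure_mono_ae ?_
          filter_upwards [hWV] with p hp hpVW
          exact hpVW.elim id hp
      _ = _ := hPV
  have hdiff : P (V \ W) = 0 := by
    rw [measure_sdiff' V hWmeas (hPW ▸ ENNReal.ofReal_ne_top), hVW, hPW, tsub_self]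
  have hEW : E =ᵐ[P] W := by
    refine ae_eq_set.2 ⟨?_, ae_le_set.1 hWE⟩
    have h1 : (E \ W : Set _) ≤ᵐ[P] (V \ W : Set _) := by
      filter_upwards [hEV] with p hp hpEW
      exact ⟨hp hpEW.1, hpEW.2⟩
    exact le_antisymm ((measure_mono_ae h1).trans_eq hdiff) zero_le
  exact ⟨by rw [measure_congr hEW, hPW], hWmeas.congr hEW.symm⟩

/-- The avoidance sets of the closed filling are null-measurable (for `A ∈ 𝒬*`).
[cite: LawlerSchrammWerner2003Restriction, Thm. 7.3 with eq. (7.3) (p. 29)] -/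
theorem SLEBubbles.nullMeasurableSet_disjoint_sleClosedBubbleSet
    (h₂ : SLEBubbles.measure_disjoint) (hκ0 : 0 < κ) (hκ : κ ≤ 8 / 3)
    (hμ : IsBrownianBubbleMeasure μ) (hX : IsPoissonCloud (bubbleCloudIntensity κ μ) X P')
    {A : Set ℂ} (hA : IsStarHull A) :
    NullMeasurableSet {p : (ℝ≥0 → ℝ) × Ω' | Disjoint (sleClosedBubbleSet κ p.1 (X p.2)) A}
      (preWienerMeasure.prod P') := by
  obtain ⟨Φ, hΦ, -⟩ := IsStarHull.existsUnique_isRestrictionMap_holds hA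
  obtain ⟨d, -, -, hd⟩ := IsStarHull.exists_hasRestrictionDeriv_holds hA hΦ
  exact (SLEBubbles.measure_disjoint_sleClosedBubbleSet_and_nullMeasurableSet h₂ hκ0 hκ hμ hX hA
    hΦ hd).2

/-- **(7.3) for the closed filling**: `P[F^ℝ_ℍ(cl(γ ∪ ⋃ X̂)) ∩ ℍ ∩ A = ∅] = Φ'_A(0)^{α_κ}` for
`A ∈ 𝒬*`. [cite: LawlerSchrammWerner2003Restriction, Thm. 7.3 with eq. (7.3) (p. 29)] -/
theorem SLEBubbles.measure_disjoint_sleClosedBubbleSet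
    (h₂ : SLEBubbles.measure_disjoint) (hκ0 : 0 < κ) (hκ : κ ≤ 8 / 3)
    (hμ : IsBrownianBubbleMeasure μ) (hX : IsPoissonCloud (bubbleCloudIntensity κ μ) X P')
    {A : Set ℂ} (hA : IsStarHull A)
    {Φ : ConformalEquiv (upperHalfPlaneSet \ A) upperHalfPlaneSet} (hΦ : IsRestrictionMap A Φ)
    {d : ℝ} (hd : HasRestrictionDeriv A Φ d) :
    (preWienerMeasure.prod P') {p | Disjoint (sleClosedBubbleSet κ p.1 (X p.2)) A} =
      ENNReal.ofReal (d ^ sleBubbleExponent κ) :=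
  (SLEBubbles.measure_disjoint_sleClosedBubbleSet_and_nullMeasurableSet h₂ hκ0 hκ hμ hX hA hΦ hd).1

/-- **The closure of `γ(0, ∞) ∪ ⋃ X̂` meets `ℝ` at most at `0`, almost surely** (it lies in
`cl Ξ(κ)`). [cite: LawlerSchrammWerner2003Restriction, proof of Thm. 7.3 (p. 29)] -/
theorem SLEBubbles.ae_closure_sleBubbleUnion_inter_range_ofReal_subset
    (h₂ : SLEBubbles.measure_disjoint) (hκ0 : 0 < κ) (hκ : κ ≤ 8 / 3)
    (hμ : IsBrownianBubbleMeasure μ) (hX : IsPoissonCloud (bubbleCloudIntensity κ μ) X P') :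
    ∀ᵐ p ∂(preWienerMeasure.prod P'),
      closure (sleBubbleUnion κ p.1 (X p.2)) ∩ range ((↑) : ℝ → ℂ) ⊆ {0} := by
  filter_upwards [SLEBubbles.ae_closure_inter_range_ofReal_subset h₂ hκ0 hκ hμ hX,
    SLEBubbles.ae_isSimpleTrace_fst hκ0 hκ P'] with p hp hγ
  have hY := sleBubbleUnion_subset_upperHalfPlaneSet hγ (X p.2)
  exact (inter_subset_inter_left _ (closure_mono (sleBubbleUnion_subset_sleBubbleSet hY))).trans hp

/-! ### The closed filling is an `Ω`-valued version of `Ξ(κ)` with law `P_{α_κ}` -/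

/-- **Almost surely `F^ℝ_ℍ(cl(γ ∪ ⋃ X̂)) ∩ ℍ ∈ Ω`** ([LSW] Thm. 7.3 read as in Thm. 8.4), from
(7.3): the trace is a.s. a simple path ([RS], `κ ≤ 4`), a.s. no bubble sits at time `0`, and a.s.
`cl(γ ∪ ⋃ X̂) ∩ ℝ ⊆ {0}` (p. 29); the rest is `sleClosedBubbleSet_mem_restrictionConfigs`.
[cite: LawlerSchrammWerner2003Restriction, Thm. 7.3 (p. 29) with Def. 3.1 (p. 10)] -/
theorem SLEBubbles.ae_sleClosedBubbleSet_mem_restrictionConfigs (h₂ : SLEBubbles.measure_disjoint)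
    (hκ0 : 0 < κ) (hκ : κ ≤ 8 / 3) (hμ : IsBrownianBubbleMeasure μ)
    (hX : IsPoissonCloud (bubbleCloudIntensity κ μ) X P') :
    ∀ᵐ p ∂(preWienerMeasure.prod P'), sleClosedBubbleSet κ p.1 (X p.2) ∈ restrictionConfigs := by
  have hsnd : ∀ᵐ p ∂(preWienerMeasure.prod P'), ∀ q ∈ X p.2, q.2 ≠ 0 :=
    (Measure.quasiMeasurePreserving_snd (μ := preWienerMeasure) (ν := P')).ae
      (SLEBubbles.ae_forall_snd_ne_zero hX)
  filter_upwards [SLEBubbles.ae_isSimpleTrace_fst hκ0 hκ P', hsnd,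
    SLEBubbles.ae_closure_sleBubbleUnion_inter_range_ofReal_subset h₂ hκ0 hκ hμ hX] with p h1 h2 h3
  exact sleClosedBubbleSet_mem_restrictionConfigs h1 h2 h3

/-- **The closed filling has a measurable `Ω`-valued version**, from (7.3)
(`RestrictionConfig.exists_measurable_version_of_nullMeasurableSet` with
`SLEBubbles.ae_sleClosedBubbleSet_mem_restrictionConfigs` and
`SLEBubbles.nullMeasurableSet_disjoint_sleClosedBubbleSet`).
[cite: LawlerSchrammWerner2003Restriction, Thm. 7.3 (p. 29) with §3 p. 10] -/
theorem SLEBubbles.exists_measurable_sleClosedBubbleSet_version (h₂ : SLEBubbles.measure_disjoint)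
    (hκ0 : 0 < κ) (hκ : κ ≤ 8 / 3) (hμ : IsBrownianBubbleMeasure μ)
    (hX : IsPoissonCloud (bubbleCloudIntensity κ μ) X P') :
    ∃ Kc : (ℝ≥0 → ℝ) × Ω' → RestrictionConfig, Measurable Kc ∧
      ∀ᵐ p ∂(preWienerMeasure.prod P'), (Kc p : Set ℂ) = sleClosedBubbleSet κ p.1 (X p.2) :=
  RestrictionConfig.exists_measurable_version_of_nullMeasurableSet
    (SLEBubbles.ae_sleClosedBubbleSet_mem_restrictionConfigs h₂ hκ0 hκ hμ hX) fun _ _ hF ↦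
    SLEBubbles.nullMeasurableSet_disjoint_sleClosedBubbleSet h₂ hκ0 hκ hμ hX hF

/-- **[LSW] Theorem 7.3 in law form, from (7.3) alone**: for `0 < κ ≤ 8/3`, a Brownian bubble
measure `μ`, an independent Poisson cloud `X` with mean `λ_κ μ ⊗ dt`, and the avoidance formula
(7.3) (`SLEBubbles.measure_disjoint`), there is a measurable `Ω`-valued `Kc` on
`((ℝ≥0 → ℝ) × Ω', preWienerMeasure ⊗ P')` which almost surely CONTAINS `Ξ(κ)` and equals the
closed filling `F^ℝ_ℍ(cl(γ(0, ∞) ∪ ⋃ X̂)) ∩ ℍ` (hence equals `Ξ(κ)` a.s. by [LSW]'s closedness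
statement `cl Ξ = Ξ ∪ {0}`, p. 29, which is not used), and whose law is the restriction measure
`P_{α_κ}`: "For any `κ ∈ [0, 8/3]`, the law of `Ξ(κ)` is `P_{α_κ}`." This replaces the pair of
hypotheses (`SLEBubbles.exists_measurable_version`, `SLEBubbles.measure_disjoint`) of
`SLEBubbles.isRestrictionMeasure_map` by the second alone.
[cite: LawlerSchrammWerner2003Restriction, Thm. 7.3 (p. 29)] -/
theorem SLEBubbles.isRestrictionMeasure_map_of_measure_disjoint (h₂ : SLEBubbles.measure_disjoint)
    {κ : ℝ≥0} (hκ0 : 0 < κ) (hκ : κ ≤ 8 / 3) {μ : Measure BubbleConfig} (hμ : IsBrownianBubbleMeasure μ)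
    {Ω' : Type} [MeasurableSpace Ω'] {P' : Measure Ω'} {X : Ω' → Set (BubbleConfig × ℝ≥0)}
    (hX : IsPoissonCloud (bubbleCloudIntensity κ μ) X P') :
    ∃ Kc : (ℝ≥0 → ℝ) × Ω' → RestrictionConfig, Measurable Kc ∧
      (∀ᵐ p ∂(preWienerMeasure.prod P'), sleBubbleSet κ p.1 (X p.2) ⊆ Kc p) ∧
      (∀ᵐ p ∂(preWienerMeasure.prod P'), (Kc p : Set ℂ) = sleClosedBubbleSet κ p.1 (X p.2)) ∧
        IsRestrictionMeasure (sleBubbleExponent κ) ((preWienerMeasure.prod P').map Kc) := by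
  haveI : IsProbabilityMeasure preWienerMeasure := isProbabilityMeasure_preWienerMeasure'
  haveI : IsProbabilityMeasure P' := hX.isProbabilityMeasure
  obtain ⟨Kc, hKc, hae⟩ := SLEBubbles.exists_measurable_sleClosedBubbleSet_version h₂ hκ0 hκ hμ hX
  refine ⟨Kc, hKc, ?_, hae, IsRestrictionMeasure.map_of_measure_disjoint hKc fun {A} hA Φ hΦ d hd ↦ ?_⟩
  · filter_upwards [hae, SLEBubbles.ae_isSimpleTrace_fst hκ0 hκ P'] with p hp hγ
    rw [hp]
    exact sleBubbleSet_subset_sleClosedBubbleSet (sleBubbleUnion_subset_upperHalfPlaneSet hγ _)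
  · have heq : ({p | Disjoint ((Kc p : Set ℂ)) A} : Set ((ℝ≥0 → ℝ) × Ω')) =ᵐ[preWienerMeasure.prod P']
        {p | Disjoint (sleClosedBubbleSet κ p.1 (X p.2)) A} :=
      hae.mono fun p hp ↦ by
        show (Disjoint ((Kc p : Set ℂ)) A) = Disjoint (sleClosedBubbleSet κ p.1 (X p.2)) A
        rw [hp]
    rw [measure_congr heq]
    exact SLEBubbles.measure_disjoint_sleClosedBubbleSet h₂ hκ0 hκ hμ hX hA hΦ hd

end Law

end Literature.Probability.RandomPlanarGeometry

end
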